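import Mathlib
import Summits.ValiantsHypothesis.ValiantsHypothesis.Theses.LiouvilleSarnak
import Summits.ValiantsHypothesis.ValiantsHypothesis.Theorems.LiouvilleSarnakDigitalBilinearLiouvilleOddTwinCore

/-!
# Route LiouvilleSarnak — crux `DigitalBilinearLiouville` (stmt-ValiantsHypothesis-14774): the prime `2` is
# IRRELEVANT for the bilinear crux — `λ` and its odd-part twin `λ_odd` are interchangeable (part 3 of 3)

For the RANK crux `LiouvilleCutRank` the two-adic mechanism `f(2m) = -f(m)` alone produces cut rank `≍ #runs`
(`…TwoAdicTwinRuns`, p831209).  For the OPERATOR-NORM crux `DigitalBilinearLiouville` the opposite holds: twisting the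
entries by the two-adic sign `f₀(N+1) = (-1)^{v₂(N+1)}` changes the normalised bilinear forms by `o(1)` uniformly
(`…OddTwinCore.twist_bilinear_le`), so the crux for `λ` is EQUIVALENT to the crux for
`λ_odd(m) = λ(m)(-1)^{v₂(m)}` (`= λ(m / 2^{v₂ m})`, completely multiplicative with `λ_odd(2) = +1`):

* ★ `digitalBilinear_twist` — the `o(2^n)` digital bilinear statement for entries `g(N+1)` (`‖g‖ ≤ 1`) implies the
  same statement for `g(N+1) (-1)^{v₂(N+1)}` (given `ε`: `2^K ≥ 4/√ε`, then `β = √ε / (2(4K+1))`).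
* ★★ `digitalBilinearLiouville_iff_oddTwin` — `DigitalBilinearLiouville ↔` the same statement with `λ_odd`.

Reading: any mechanism that only uses `λ(2) = -1` (Conjecture-C-type arguments, window-embedding signs) contributes
NOTHING to 14774; the bilinear crux is a statement about `λ` on odd parts, i.e. about the odd primes only.  Honest
framing: an equivalence of two open statements; `DigitalBilinearLiouville`, `LiouvilleCutRank`, `AlgebraicSarnak`
stay OPEN; nothing bears on `VP ≠ VNP`.  No definitions.
-/

set_option linter.dupNamespace false

noncomputable section

namespace Summit.ValiantsHypothesis.ValiantsHypothesis.Theorems.LiouvilleSarnakDigitalBilinearLiouville.OddTwin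

open ArithmeticFunction Finset

open Summit.ValiantsHypothesis.ValiantsHypothesis.Theses.LiouvilleSarnak (DigitalBilinearLiouville)
open Summit.ValiantsHypothesis.ValiantsHypothesis.Theorems.LiouvilleSarnakDigitalBilinearLiouville.OddTwinCore (twist_bilinear_le)

/-! ### §4 The crux-level transfer -/

/-- ★ **Twisting by `(-1)^{v₂}` preserves the digital bilinear `o(2^n)` statement.**  If the entries `g(N+1)`
(`‖g‖ ≤ 1`) satisfy the `DigitalBilinearLiouville`-shaped bound for every `ε`, so do the entries
`g(N+1) · (-1)^{v₂(N+1)}`. [this file] -/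
theorem digitalBilinear_twist (g : ℕ → ℂ) (hg : ∀ m, ‖g m‖ ≤ 1)
    (h : ∀ ε : ℝ, 0 < ε → ∃ n₀ : ℕ, ∀ n ≥ n₀, ∀ π : Fin n ⊕ Fin n ≃ Fin (2 * n),
      ∀ u w : (Fin n → Bool) → ℂ,
        ‖∑ r : Fin n → Bool, ∑ c : Fin n → Bool, u r * w c *
            g (Nat.ofBits (fun j : Fin (2 * n) => Sum.elim r c (π.symm j)) + 1)‖ ^ 2 ≤
          ε * 4 ^ n * (∑ r : Fin n → Bool, ‖u r‖ ^ 2) * (∑ c : Fin n → Bool, ‖w c‖ ^ 2)) :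
    ∀ ε : ℝ, 0 < ε → ∃ n₀ : ℕ, ∀ n ≥ n₀, ∀ π : Fin n ⊕ Fin n ≃ Fin (2 * n),
      ∀ u w : (Fin n → Bool) → ℂ,
        ‖∑ r : Fin n → Bool, ∑ c : Fin n → Bool, u r * w c *
            (g (Nat.ofBits (fun j : Fin (2 * n) => Sum.elim r c (π.symm j)) + 1) *
              (-1 : ℂ) ^ ((Nat.ofBits (fun j : Fin (2 * n) => Sum.elim r c (π.symm j)) + 1).factorization 2))‖ ^ 2 ≤
          ε * 4 ^ n * (∑ r : Fin n → Bool, ‖u r‖ ^ 2) * (∑ c : Fin n → Bool, ‖w c‖ ^ 2) := by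
  intro ε hε
  set δ := Real.sqrt ε with hδ
  have hδ0 : 0 < δ := Real.sqrt_pos.mpr hε
  have hδsq : δ ^ 2 = ε := Real.sq_sqrt hε.le
  -- `K` with `2^K ≥ 4/δ`
  obtain ⟨K, hK⟩ : ∃ K : ℕ, 4 / δ ≤ (2 : ℝ) ^ K :=
    ⟨Nat.clog 2 ⌈4 / δ⌉₊, (Nat.le_ceil _).trans (by exact_mod_cast Nat.le_pow_clog one_lt_two _)⟩
  set β₀ : ℝ := δ / (2 * (4 * K + 1)) with hβ₀
  have hβ₀pos : 0 < β₀ := by positivity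
  obtain ⟨n₁, hn₁⟩ := h (β₀ ^ 2) (by positivity)
  refine ⟨max n₁ (K + 1), fun n hn π u w => ?_⟩
  have hn1 : n₁ ≤ n := le_of_max_le_left hn
  have hKn : K < n := by have := le_of_max_le_right hn; omega
  set U := Real.sqrt (∑ r, ‖u r‖ ^ 2) with hU
  set V := Real.sqrt (∑ c, ‖w c‖ ^ 2) with hV
  have hU0 : 0 ≤ U := Real.sqrt_nonneg _
  have hV0 : 0 ≤ V := Real.sqrt_nonneg _
  have hUsq : U ^ 2 = ∑ r, ‖u r‖ ^ 2 := Real.sq_sqrt (Finset.sum_nonneg fun _ _ => by positivity)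
  have hVsq : V ^ 2 = ∑ c, ‖w c‖ ^ 2 := Real.sq_sqrt (Finset.sum_nonneg fun _ _ => by positivity)
  -- the hypothesis in `β`-form at this level
  set G : (Fin n → Bool) → (Fin n → Bool) → ℂ := fun r c =>
    g (Nat.ofBits (fun j : Fin (2 * n) => Sum.elim r c (π.symm j)) + 1) with hGdef
  have hG1 : ∀ r c, ‖G r c‖ ≤ 1 := fun r c => hg _
  have hβ : ∀ u' w' : (Fin n → Bool) → ℂ,
      ‖∑ r, ∑ c, u' r * w' c * G r c‖ ≤
        (β₀ * 2 ^ n) * Real.sqrt (∑ r, ‖u' r‖ ^ 2) * Real.sqrt (∑ c, ‖w' c‖ ^ 2) := by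
    intro u' w'
    have h2 := hn₁ n hn1 π u' w'
    have hrhs : β₀ ^ 2 * 4 ^ n * (∑ r, ‖u' r‖ ^ 2) * (∑ c, ‖w' c‖ ^ 2) =
        ((β₀ * 2 ^ n) * Real.sqrt (∑ r, ‖u' r‖ ^ 2) * Real.sqrt (∑ c, ‖w' c‖ ^ 2)) ^ 2 := by
      rw [mul_pow, mul_pow, mul_pow, Real.sq_sqrt (Finset.sum_nonneg fun _ _ => by positivity),
        Real.sq_sqrt (Finset.sum_nonneg fun _ _ => by positivity), ← pow_mul,
        show (4 : ℝ) ^ n = 2 ^ (n * 2) by rw [mul_comm, pow_mul]; norm_num]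
    rw [hrhs] at h2
    have hnn : 0 ≤ (β₀ * 2 ^ n) * Real.sqrt (∑ r, ‖u' r‖ ^ 2) * Real.sqrt (∑ c, ‖w' c‖ ^ 2) := by
      positivity
    exact (pow_le_pow_iff_left₀ (norm_nonneg _) hnn two_ne_zero).mp h2
  have hcore := twist_bilinear_le n K hKn π G hG1 (β₀ * 2 ^ n) (by positivity) hβ u w
  rw [← hU, ← hV] at hcore
  -- the constant is at most `δ 2^n`
  have h2K : (2 : ℝ) ^ n = 2 ^ (n - K) * 2 ^ K := by
    rw [← pow_add]; congr 1; omega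
  have hconst : (4 * K + 1) * (β₀ * 2 ^ n) + 2 * 2 ^ (n - K) ≤ δ * (2 : ℝ) ^ n := by
    have h1 : (4 * (K : ℝ) + 1) * (β₀ * 2 ^ n) = δ / 2 * 2 ^ n := by
      have h4 : (4 * (K : ℝ) + 1) ≠ 0 := by positivity
      have h5 : (4 * (K : ℝ) + 1) * β₀ = δ / 2 := by
        rw [hβ₀, mul_comm, div_mul_eq_mul_div, mul_comm (2 : ℝ) _, ← div_div, mul_div_assoc,
          div_self h4, mul_one]
      rw [← mul_assoc, h5]
    have h2 : 2 * (2 : ℝ) ^ (n - K) ≤ δ / 2 * 2 ^ n := by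
      rw [h2K]
      have h2K0 : (0 : ℝ) < 2 ^ (n - K) := by positivity
      -- `2 ≤ (δ/2) 2^K` from `4/δ ≤ 2^K`
      have h3 : 2 ≤ δ / 2 * (2 : ℝ) ^ K := by
        have := mul_le_mul_of_nonneg_left hK (by positivity : (0 : ℝ) ≤ δ / 2)
        have h5 : δ / 2 * (4 / δ) = 2 := by
          calc δ / 2 * (4 / δ) = (δ / δ) * 2 := by ring
            _ = 2 := by rw [div_self hδ0.ne', one_mul]
        rw [h5] at this
        exact this
      nlinarith
    rw [h1]; linarith
  have hfin : ‖∑ r, ∑ c, u r * w c *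
        (G r c * (-1 : ℂ) ^ ((Nat.ofBits (fun k : Fin (2 * n) => Sum.elim r c (π.symm k)) + 1).factorization 2))‖ ≤
      δ * 2 ^ n * U * V := by
    refine hcore.trans ?_
    have : ((4 * K + 1) * (β₀ * 2 ^ n) + 2 * 2 ^ (n - K)) * U * V ≤ (δ * 2 ^ n) * U * V := by gcongr
    exact this
  have hnn : 0 ≤ δ * 2 ^ n * U * V := by positivity
  have hsq := pow_le_pow_left₀ (norm_nonneg _) hfin 2
  have hrhs : (δ * 2 ^ n * U * V) ^ 2 = ε * 4 ^ n * (∑ r, ‖u r‖ ^ 2) * (∑ c, ‖w c‖ ^ 2) := by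
    rw [mul_pow, mul_pow, mul_pow, hδsq, hUsq, hVsq, ← pow_mul,
      show (2 : ℝ) ^ (n * 2) = 4 ^ n by rw [mul_comm, pow_mul]; norm_num]
  rw [hrhs] at hsq
  simpa only [hGdef, mul_assoc] using hsq

/-- ★★ **`DigitalBilinearLiouville` for `λ` ⟺ for the odd-part twin `λ_odd`.**  The crux is equivalent to the
same statement with `λ(N+1)` replaced by `λ_odd(N+1) = λ(N+1) · (-1)^{v₂(N+1)}` (`= λ` of the odd part of
`N+1`): the two-adic sign is invisible to the digital bilinear `o(2^n)` statement. [this file] -/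
theorem digitalBilinearLiouville_iff_oddTwin :
    DigitalBilinearLiouville ↔
      ∀ ε : ℝ, 0 < ε → ∃ n₀ : ℕ, ∀ n ≥ n₀, ∀ π : Fin n ⊕ Fin n ≃ Fin (2 * n),
        ∀ u w : (Fin n → Bool) → ℂ,
          ‖∑ r : Fin n → Bool, ∑ c : Fin n → Bool, u r * w c *
              ((((liouville (Nat.ofBits (fun j : Fin (2 * n) => Sum.elim r c (π.symm j)) + 1) : ℤ) : ℂ)) *
                (-1 : ℂ) ^ ((Nat.ofBits (fun j : Fin (2 * n) => Sum.elim r c (π.symm j)) + 1).factorization 2))‖ ^ 2 ≤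
            ε * 4 ^ n * (∑ r : Fin n → Bool, ‖u r‖ ^ 2) * (∑ c : Fin n → Bool, ‖w c‖ ^ 2) := by
  have hl1 : ∀ m : ℕ, ‖(((liouville m : ℤ)) : ℂ)‖ ≤ 1 := by
    intro m
    rcases Nat.eq_zero_or_pos m with h0 | hpos
    · subst h0; simp
    · rw [liouville_apply hpos.ne']
      push_cast
      rw [norm_pow, norm_neg, norm_one, one_pow]
  have hsq1 : ∀ m : ℕ, ((-1 : ℂ) ^ (m.factorization 2)) * ((-1 : ℂ) ^ (m.factorization 2)) = 1 := by
    intro m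
    rw [← mul_pow]; norm_num
  constructor
  · intro h
    exact digitalBilinear_twist (fun m => (((liouville m : ℤ)) : ℂ)) hl1 h
  · intro h
    have h2 := digitalBilinear_twist (fun m => (((liouville m : ℤ)) : ℂ) * (-1 : ℂ) ^ (m.factorization 2))
      (fun m => by
        rw [norm_mul, norm_pow, norm_neg, norm_one, one_pow, mul_one]; exact hl1 m) h
    intro ε hε
    obtain ⟨n₀, hn₀⟩ := h2 ε hε
    refine ⟨n₀, fun n hn π u w => ?_⟩
    have h3 := hn₀ n hn π u w
    have hent : ∀ r c : Fin n → Bool,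
        ((liouville (Nat.ofBits (fun j : Fin (2 * n) => Sum.elim r c (π.symm j)) + 1) : ℤ) : ℂ) *
            (-1 : ℂ) ^ ((Nat.ofBits (fun j : Fin (2 * n) => Sum.elim r c (π.symm j)) + 1).factorization 2) *
          (-1 : ℂ) ^ ((Nat.ofBits (fun j : Fin (2 * n) => Sum.elim r c (π.symm j)) + 1).factorization 2) =
        ((liouville (Nat.ofBits (fun j : Fin (2 * n) => Sum.elim r c (π.symm j)) + 1) : ℤ) : ℂ) := by
      intro r c
      rw [mul_assoc, hsq1, mul_one]
    simp only [hent] at h3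
    exact h3

end Summit.ValiantsHypothesis.ValiantsHypothesis.Theorems.LiouvilleSarnakDigitalBilinearLiouville.OddTwin

end
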